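/-
Copyright (c) 2026. All rights reserved.
Released under Apache 2.0 license as described in the file LICENSE.
Authors: abc-iut cell — seat abc-iut-w5-d226 (wave 5), over abc-iut-L4-t2 and -t14's `ArchimedeanLogFrobenius`.
-/
import Literature.AnabelianGeometry.AbsoluteAnabelian.ArchimedeanLogFrobenius
import Literature.AnabelianGeometry.AbsoluteAnabelian.AutHolomorphicSpacesProofs
import Mathlib.Analysis.SpecificLimits.Normed
import HarnessLib

/-!
# [AbsTopIII] Proposition 4.2 — sub-DAG of the printed proof (D-0068 (1), statements-first)

S. Mochizuki, *Topics in absolute anabelian geometry III*, §4, Prop 4.2 "First Properties of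
Aut-Holomorphic Pairs", kurims pp.105–106, proof p.106 (bib key `MochizukiAbsTopIII2015`; lit key
`paper:url-5493eb38cbb7`, read on the page).  Companion table `plan/L4/SUBDAG-AbsTopIII-Prop42.md` of the
abc-iut cell (nodes `AbsTopIII:Prop4.2(i)`, `(ii)`; sub-node ids `P42.*`).  Prop 4.2 (i): for
`T ∈ {TM, TF, TLG, TCG}` "the natural functor of Definition 4.1, (iii), induces a bijection
`Isom_{𝒞^hol_T}((𝕏 ↶ M),(𝕏* ↶ M*)) ⥲ Isom_EA(𝕏, 𝕏*)` … In particular, the categories `EA`, `𝒞^hol_T = 𝒞̲^hol_T`,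
`𝒞^{hol-sB}_T = 𝒞̲^{hol-sB}_T` are id-rigid"; proof: "The bijectivity portion … follows immediately from the
required compatibility of morphisms of `𝒞^hol_T` with the Kummer structures of the objects involved
[cf. also the functorial algorithms of Corollary 2.7]".

Typed/proved here over the LANDED `ArchimedeanLogFrobenius.lean` (where Prop 4.2 (i) itself is NOT typed:
the isomorphism `𝒜_𝕏 ⥲ 𝒜_𝕏*` INDUCED by a structure-isomorphism through Cor 2.7 is not constructed in the
tree, `AutHolPair.Iso.isoA` is free data):
* **P42.J27 (junction)** — every sub-node needing "the functorial algorithms of Corollary 2.7" takes the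
  induced isomorphism of TOPOLOGICAL fields as a BINDER `(ψA : P.A.F ≃+* Q.A.F)` + continuity both ways
  (no `Prop` hypothesis structure, cell rule D-0067 (1); GAP-LEDGER row G-w5d226-1).
* **P42.i/L03 (PROVED)** — Def 4.1 (iii) bracket p.103 ("elements `a` such that `aⁿ → 0`"): the data
  `k, 𝒪_k^×, k^×, 𝒪_k^⊳` are intrinsic to the topological field (`ArchProp42.norm_lt_one_iff` …,
  `ModelAutHolPair.image_arithData_eq`).
* **P42.i/L04 (PROVED)** — surjectivity for MODEL pairs: `(u, ψA)` lifts to an isomorphism of pairs with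
  `isoM = κ_{k*}⁻¹ ∘ ψA ∘ κ_k` (`ModelAutHolPair.liftIso`; statement `ModelStructureIsoLifts`).
* **P42.i/L05 (PROVED)** — Def 4.1 (ii) (c) transport: isomorphisms of pairs compose and invert
  (`AutHolPair.Iso.refl/symm/trans` over `IsMorphism.comp/.symm`), hence surjectivity for pairs
  presented by models with bicontinuous `𝒜`-parts — automatic in print (`StructureIsoLifts`).
* **P42.i/L02 (tree, PROVED)** — injectivity: `AutHolPair.Iso.isoM_eq_of_isoA_eq`; here `Iso.ext`,
  `Iso.eq_of_isoU_eq_of_isoA_eq`.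
* **P42.i/L06 (PROVED relative to the junction)** — the bijection assembled over a junction binder
  `ind` (`IsomBijectionRel`, `isomBijectionRel_of_lifts`).
* **P42.i/L07 (PROVED for model pairs)** — "`𝒞^hol_T = 𝒞̲^hol_T`": a morphism whose `𝒜`-part is an induced
  isomorphism of topological fields has bijective `φ_M` (`ModelAutHolPair.homM_bijective_of_fieldIso`).
* **P42.i/L08–L12, P42.ii (table only)** — id-rigidity of `EA`, `𝒞^hol_T = 𝒞̲^hol_T` (Cor 2.3 (i), [Mzk14]
  Lem 1.3 (iii), [Mzk10] §2, Lemma 4.3) needs `EA`/`𝒞^hol_T` packaged with FINITE ÉTALE morphisms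
  (composition of `IsFiniteEtale` not in tree); Rmk 4.2.1; Prop 4.2 (ii)'s object-level shadow is
  abc-iut-L4-t14's staged `ArchimedeanLogFrobeniusFunctors.lean`.

Refereed pre-IUT anabelian geometry; nothing here bears on the disputed [IUTchIII] Cor. 3.12; no
published result is asserted without proof; typed ≠ discharged except where a proof is given.
-/

namespace Literature.AnabelianGeometry.AbsoluteAnabelian

open _root_.TopologicalSpace _root_.Topology _root_.Filter

universe u

noncomputable section

/-! ### P42.i/L03 — the arithmetic data `M_k ⊆ k` are intrinsic to the topological field -/

namespace ArchProp42

variable {k : Type*} [NormedField k] {k' : Type*} [NormedField k']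

/-- A bicontinuous ring isomorphism of normed fields preserves "`‖x‖ < 1`": indeed `‖x‖ < 1 ⟺ xⁿ → 0`
(the bracket of Def 4.1 (iii): "elements `a` such that `aⁿ → 0` as `n → ∞`"), a condition on the
topological field alone. [cite: MochizukiAbsTopIII2015, Definition 4.1 (iii) p.103] -/
theorem norm_lt_one_iff (σ : k ≃+* k') (hσ : Continuous σ) (hσ' : Continuous σ.symm) (x : k) :
    ‖σ x‖ < 1 ↔ ‖x‖ < 1 := by
  rw [← tendsto_pow_atTop_nhds_zero_iff_norm_lt_one, ← tendsto_pow_atTop_nhds_zero_iff_norm_lt_one]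
  constructor
  · intro h
    have h' : Tendsto (fun n : ℕ => σ.symm ((σ x) ^ n)) atTop (𝓝 (σ.symm 0)) :=
      (hσ'.tendsto 0).comp h
    simpa only [map_pow, map_zero, RingEquiv.symm_apply_apply] using h'
  · intro h
    have h' : Tendsto (fun n : ℕ => σ (x ^ n)) atTop (𝓝 (σ 0)) := (hσ.tendsto 0).comp h
    simpa only [map_pow, map_zero] using h'

/-- … and preserves "`1 < ‖x‖`" (apply to `x⁻¹`). [cite: MochizukiAbsTopIII2015, Definition 4.1 (iii) p.103] -/
theorem one_lt_norm_iff (σ : k ≃+* k') (hσ : Continuous σ) (hσ' : Continuous σ.symm) (x : k) :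
    1 < ‖σ x‖ ↔ 1 < ‖x‖ := by
  by_cases hx : x = 0
  · subst hx; simp
  · have hx' : σ x ≠ 0 := (map_ne_zero σ).2 hx
    have h := norm_lt_one_iff σ hσ hσ' x⁻¹
    rw [map_inv₀, norm_inv, norm_inv, inv_lt_one₀ (norm_pos_iff.2 hx'),
      inv_lt_one₀ (norm_pos_iff.2 hx)] at h
    exact h

/-- … and preserves "`‖x‖ ≤ 1`": the subset `𝒪_k` of Def 4.1 (i) is intrinsic to the topological field.
[cite: MochizukiAbsTopIII2015, Definition 4.1 (i) p.101] -/
theorem norm_le_one_iff (σ : k ≃+* k') (hσ : Continuous σ) (hσ' : Continuous σ.symm) (x : k) :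
    ‖σ x‖ ≤ 1 ↔ ‖x‖ ≤ 1 := by
  rw [← not_lt, ← not_lt, one_lt_norm_iff σ hσ hσ' x]

/-- … and preserves "`‖x‖ = 1`": the unit group `𝒪_k^×` of Def 4.1 (i) is intrinsic to the topological field.
[cite: MochizukiAbsTopIII2015, Definition 4.1 (i) p.101] -/
theorem norm_eq_one_iff (σ : k ≃+* k') (hσ : Continuous σ) (hσ' : Continuous σ.symm) (x : k) :
    ‖σ x‖ = 1 ↔ ‖x‖ = 1 := by
  rw [le_antisymm_iff, le_antisymm_iff]
  exact and_congr (norm_le_one_iff σ hσ hσ' x)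
    (by rw [← not_lt, ← not_lt, norm_lt_one_iff σ hσ hσ' x])

end ArchProp42

namespace ModelAutHolPair

variable {T : ArchPairType}

/-- **P42.i/L03**: a bicontinuous field isomorphism `σ : k ⥲ k*` between the CAFs of two model
Aut-holomorphic `T`-pairs maps the arithmetic data `M_k` ONTO `M_{k*}` (`k`, `𝒪_k^×`, `k^×`, `𝒪_k^⊳` by
type) — "the formation of `𝒪_k^⊳` (respectively, `k^×`; `𝒪_k^×`; `𝒪_k^×`) from `k` … is clearly intrinsically
defined [i.e., depends only on the 'input data of an object of `T`']".
[cite: MochizukiAbsTopIII2015, Definition 4.1 (iii) p.103] -/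
theorem image_arithData_eq (P Q : ModelAutHolPair.{u} T) (σ : P.k ≃+* Q.k) (hσ : Continuous σ)
    (hσ' : Continuous σ.symm) : σ '' P.arithData = Q.arithData := by
  have h1 := ArchProp42.norm_eq_one_iff σ hσ hσ'
  have h2 := ArchProp42.norm_le_one_iff σ hσ hσ'
  have h3 := ArchProp42.norm_eq_one_iff σ.symm hσ' (by simpa using hσ)
  have h4 := ArchProp42.norm_le_one_iff σ.symm hσ' (by simpa using hσ)
  ext y
  constructor
  · rintro ⟨x, hx, rfl⟩
    cases T <;> simp_all [arithData]
  · exact fun hy => ⟨σ.symm y, by cases T <;> simp_all [arithData], σ.apply_symm_apply y⟩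

end ModelAutHolPair

/-! ### P42.i/L05 — isomorphisms of Aut-holomorphic pairs compose and invert (Def 4.1 (ii) (c)) -/

/-- Structure-isomorphisms of presentations compose (`IsMorphism.comp`, Rmk 2.3.3 on the generalised
carrier). [cite: MochizukiAbsTopIII2015, Definition 4.1 (ii) p.102] -/
theorem structureIso_trans {X Y Z : AutHolOrbiPresentation.{u}} {a : X.U ≃ₜ Y.U} {b : Y.U ≃ₜ Z.U}
    (ha : IsMorphism X.str Y.str a ∧ IsMorphism Y.str X.str a.symm)
    (hb : IsMorphism Y.str Z.str b ∧ IsMorphism Z.str Y.str b.symm) :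
    IsMorphism X.str Z.str (a.trans b) ∧ IsMorphism Z.str X.str (a.trans b).symm :=
  have h1 : (⇑b ∘ ⇑a) = ⇑(a.trans b) := funext fun _ => rfl
  have h2 : (⇑a.symm ∘ ⇑b.symm) = ⇑(a.trans b).symm := funext fun _ => rfl
  ⟨h1 ▸ hb.1.comp ha.1, h2 ▸ ha.2.comp hb.2⟩

namespace AutHolPair

variable {P Q R : AutHolPair.{u}}

/-- Two isomorphisms of Aut-holomorphic pairs with the same structure-isomorphism, the same
`𝒜`-part and the same arithmetic part are equal (the remaining fields are propositions).
[cite: MochizukiAbsTopIII2015, Definition 4.1 (ii) p.102] -/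
@[ext]
theorem Iso.ext {e f : P.Iso Q} (hU : e.isoU = f.isoU) (hA : e.isoA = f.isoA) (hM : e.isoM = f.isoM) :
    e = f := by
  cases e
  cases f
  congr

/-- An isomorphism of Aut-holomorphic `T`-pairs is determined by its structure-isomorphism AND its
`𝒜`-part — the formal core of the injectivity of `Isom_𝒞 → Isom_EA` (Kummer compatibility; with the
`𝒜`-part INDUCED by the structure-isomorphism, junction P42.J27, this is the printed injectivity).
[cite: MochizukiAbsTopIII2015, Proposition 4.2 (i) p.105] -/
theorem Iso.eq_of_isoU_eq_of_isoA_eq {T : ArchPairType} (hQ : IsAutHolPair T Q) (e f : P.Iso Q)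
    (hU : e.isoU = f.isoU) (hA : e.isoA = f.isoA) : e = f :=
  Iso.ext hU hA (Iso.isoM_eq_of_isoA_eq hQ e f hA)

/-- The identity isomorphism of an Aut-holomorphic pair.
[cite: MochizukiAbsTopIII2015, Definition 4.1 (ii) p.102] -/
def Iso.refl (P : AutHolPair.{u}) : P.Iso P where
  isoU := Homeomorph.refl P.U
  isoU_isMorphism := ⟨P.X.str.isMorphism_id, P.X.str.isMorphism_id⟩
  isoA := RingEquiv.refl _
  isoM := MulEquiv.refl _
  continuous_isoM := ⟨continuous_id, continuous_id⟩
  kummer_compat _ := rfl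

/-- The inverse of an isomorphism of Aut-holomorphic pairs (Kummer compatibility inverts because the
`𝒜`-part is an isomorphism of fields). [cite: MochizukiAbsTopIII2015, Definition 4.1 (ii) p.102] -/
def Iso.symm (e : P.Iso Q) : Q.Iso P where
  isoU := e.isoU.symm
  isoU_isMorphism := ⟨e.isoU_isMorphism.2, by simpa using e.isoU_isMorphism.1⟩
  isoA := e.isoA.symm
  isoM := e.isoM.symm
  continuous_isoM := ⟨e.continuous_isoM.2, e.continuous_isoM.1⟩
  kummer_compat m := by
    apply e.isoA.injective
    rw [← e.kummer_compat, MulEquiv.apply_symm_apply, RingEquiv.apply_symm_apply]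

/-- The composite of two isomorphisms of Aut-holomorphic pairs (structure-isomorphisms compose:
`IsMorphism.comp`). [cite: MochizukiAbsTopIII2015, Definition 4.1 (ii) p.102] -/
def Iso.trans (e : P.Iso Q) (f : Q.Iso R) : P.Iso R where
  isoU := e.isoU.trans f.isoU
  isoU_isMorphism := structureIso_trans e.isoU_isMorphism f.isoU_isMorphism
  isoA := e.isoA.trans f.isoA
  isoM := e.isoM.trans f.isoM
  continuous_isoM :=
    ⟨f.continuous_isoM.1.comp e.continuous_isoM.1, e.continuous_isoM.2.comp f.continuous_isoM.2⟩
  kummer_compat m := by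
    simp only [MulEquiv.trans_apply, RingEquiv.trans_apply, f.kummer_compat, e.kummer_compat]

end AutHolPair

/-! ### P42.i/L04 — the lift for MODEL pairs -/

namespace ModelAutHolPair

variable {T : ArchPairType} (P Q : ModelAutHolPair.{u} T)
  (hP₁ : ∀ x y : P.k, x ∈ P.arithData → y ∈ P.arithData → x * y ∈ P.arithData)
  (hP₂ : (1 : P.k) ∈ P.arithData)
  (hQ₁ : ∀ x y : Q.k, x ∈ Q.arithData → y ∈ Q.arithData → x * y ∈ Q.arithData)
  (hQ₂ : (1 : Q.k) ∈ Q.arithData)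

/-- The field isomorphism `σ := κ_{k*}⁻¹ ∘ ψA ∘ κ_k : k ⥲ k*` determined by an isomorphism
`ψA : 𝒜_𝕏 ⥲ 𝒜_𝕏*` of the fields of two model pairs and their Kummer structures ("compatible with the
respective Kummer structures"). [cite: MochizukiAbsTopIII2015, Definition 4.1 (ii) p.102] -/
def fieldIsoOfA (ψA : P.A.F ≃+* Q.A.F) : P.k ≃+* Q.k := P.κ.κ.trans (ψA.trans Q.κ.κ.symm)

/-- [cite: MochizukiAbsTopIII2015, Definition 4.1 (ii) p.102] -/
@[simp] theorem fieldIsoOfA_apply (ψA : P.A.F ≃+* Q.A.F) (x : P.k) :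
    fieldIsoOfA P Q ψA x = Q.κ.κ.symm (ψA (P.κ.κ x)) := rfl

/-- `σ` is continuous when `ψA` is. [cite: MochizukiAbsTopIII2015, Definition 4.1 (ii) p.102] -/
theorem continuous_fieldIsoOfA (ψA : P.A.F ≃+* Q.A.F) (hψ : Continuous ψA) :
    Continuous (fieldIsoOfA P Q ψA) :=
  Q.κ.continuous_κ_symm.comp (hψ.comp P.κ.continuous_κ)

/-- `σ⁻¹` is continuous when `ψA⁻¹` is. [cite: MochizukiAbsTopIII2015, Definition 4.1 (ii) p.102] -/
theorem continuous_fieldIsoOfA_symm (ψA : P.A.F ≃+* Q.A.F) (hψ' : Continuous ψA.symm) :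
    Continuous (fieldIsoOfA P Q ψA).symm :=
  show Continuous (fun y => P.κ.κ.symm (ψA.symm (Q.κ.κ y))) from
    P.κ.continuous_κ_symm.comp (hψ'.comp Q.κ.continuous_κ)

/-- The isomorphism of arithmetic data `M_k ⥲ M_{k*}` induced by a field isomorphism `σ : k ⥲ k*` mapping
`M_k` onto `M_{k*}`. [cite: MochizukiAbsTopIII2015, Definition 4.1 (iii) p.103] -/
def arithIso (σ : P.k ≃+* Q.k) (hσ : σ '' P.arithData = Q.arithData) :
    (P.toPair hP₁ hP₂).M ≃* (Q.toPair hQ₁ hQ₂).M where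
  toFun x := ⟨σ x.1, by
    change σ x.1 ∈ Q.arithData
    rw [← hσ]
    exact ⟨x.1, x.2, rfl⟩⟩
  invFun y := ⟨σ.symm y.1, by
    change σ.symm y.1 ∈ P.arithData
    have hy : (y.1 : Q.k) ∈ σ '' P.arithData := by rw [hσ]; exact y.2
    obtain ⟨x, hx, hxy⟩ := hy
    rw [← hxy, σ.symm_apply_apply]
    exact hx⟩
  left_inv x := Subtype.ext (σ.symm_apply_apply x.1)
  right_inv y := Subtype.ext (σ.apply_symm_apply y.1)
  map_mul' x y := Subtype.ext (map_mul σ x.1 y.1)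

/-- **P42.i/L04 — the lift.**  For model Aut-holomorphic `T`-pairs, a structure-isomorphism `u : 𝕏 ⥲ 𝕏*`
together with the isomorphism of topological fields `ψA : 𝒜_𝕏 ⥲ 𝒜_𝕏*` it induces (junction P42.J27)
LIFTS to an isomorphism of pairs: `isoM := κ_{k*}⁻¹ ∘ ψA ∘ κ_k` restricted to `M_k ⥲ M_{k*}` (P42.i/L03),
Kummer-compatible by construction.
[cite: MochizukiAbsTopIII2015, Proposition 4.2 (i) p.105] -/
def liftIso (u : P.U ≃ₜ Q.U) (hu : IsMorphism P.X.str Q.X.str u ∧ IsMorphism Q.X.str P.X.str u.symm)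
    (ψA : P.A.F ≃+* Q.A.F) (hψ : Continuous ψA) (hψ' : Continuous ψA.symm) :
    (P.toPair hP₁ hP₂).Iso (Q.toPair hQ₁ hQ₂) where
  isoU := u
  isoU_isMorphism := hu
  isoA := ψA
  isoM := arithIso P Q hP₁ hP₂ hQ₁ hQ₂ (fieldIsoOfA P Q ψA)
    (image_arithData_eq P Q _ (continuous_fieldIsoOfA P Q ψA hψ)
      (continuous_fieldIsoOfA_symm P Q ψA hψ'))
  continuous_isoM := by
    constructor
    · exact Continuous.subtype_mk
        ((continuous_fieldIsoOfA P Q ψA hψ).comp continuous_subtype_val) _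
    · exact Continuous.subtype_mk
        ((continuous_fieldIsoOfA_symm P Q ψA hψ').comp continuous_subtype_val) _
  kummer_compat m := by
    change Q.κ.κ (fieldIsoOfA P Q ψA m.1) = ψA (P.κ.κ m.1)
    rw [fieldIsoOfA_apply, RingEquiv.apply_symm_apply]

/-- **P42.i/L07 — "`𝒞^hol_T = 𝒞̲^hol_T`" for model pairs**: a morphism of Aut-holomorphic `T`-pairs
`φ : (𝕏 ↶ M_k) → (𝕏* ↶ M_{k*})` whose `𝒜`-part is an induced isomorphism of TOPOLOGICAL fields `ψA`
(junction P42.J27: in print `φ_𝒜` is induced by the finite étale `φ_𝕏` through the functorial algorithms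
of Cor 2.7, an isomorphism since both fields are CAFs) is a `T`-isomorphism, i.e. `φ_M` is BIJECTIVE:
injective by Kummer compatibility, surjective because `κ_{k*}⁻¹ ∘ ψA ∘ κ_k` maps `M_k` onto `M_{k*}`
(P42.i/L03).  (`AutHolPair.Hom.IsTIso` also asks `φ_M` to be open; not addressed here.)
[cite: MochizukiAbsTopIII2015, Proposition 4.2 (i) p.105] -/
theorem homM_bijective_of_fieldIso (φ : (P.toPair hP₁ hP₂).Hom (Q.toPair hQ₁ hQ₂))
    (ψA : P.A.F ≃+* Q.A.F) (hφ : ∀ a, φ.homA a = ψA a) (hψ : Continuous ψA)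
    (hψ' : Continuous ψA.symm) : Function.Bijective φ.homM := by
  have hinjQ := Q.toPair_κM_injective hQ₁ hQ₂
  constructor
  · intro x y hxy
    have h := congrArg (Q.toPair hQ₁ hQ₂).κM hxy
    rw [φ.kummer_compat, φ.kummer_compat, hφ, hφ] at h
    exact P.toPair_κM_injective hP₁ hP₂ (ψA.injective h)
  · intro y
    have hσ := image_arithData_eq P Q (fieldIsoOfA P Q ψA) (continuous_fieldIsoOfA P Q ψA hψ)
      (continuous_fieldIsoOfA_symm P Q ψA hψ')
    have hy : (y.1 : Q.k) ∈ fieldIsoOfA P Q ψA '' P.arithData := by rw [hσ]; exact y.2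
    obtain ⟨x, hx, hxy⟩ := hy
    refine ⟨⟨x, hx⟩, hinjQ ?_⟩
    rw [φ.kummer_compat, hφ]
    change ψA (P.κ.κ x) = Q.κ.κ y.1
    rw [← hxy, fieldIsoOfA_apply, RingEquiv.apply_symm_apply]

end ModelAutHolPair

/-- **P42.i/L04 — statement** (sub-node of [AbsTopIII] Prop 4.2 (i), surjectivity of
`Isom_{𝒞^hol_T} → Isom_EA` for MODEL pairs): every structure-isomorphism `u : 𝕏_ell ⥲ 𝕏*_ell`, together with
the isomorphism of topological fields `ψA : 𝒜_𝕏 ⥲ 𝒜_𝕏*` it induces via the functorial algorithms of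
Cor 2.7 (junction P42.J27, a binder here), is the image of an isomorphism of pairs
`(𝕏 ↶ M_k) ⥲ (𝕏* ↶ M_{k*})` with exactly these structure- and `𝒜`-parts.
[cite: MochizukiAbsTopIII2015, Proposition 4.2 (i) p.105] -/
def ModelStructureIsoLifts (T : ArchPairType) : Prop :=
  ∀ (P Q : ModelAutHolPair.{u} T)
    (hP₁ : ∀ x y : P.k, x ∈ P.arithData → y ∈ P.arithData → x * y ∈ P.arithData)
    (hP₂ : (1 : P.k) ∈ P.arithData)
    (hQ₁ : ∀ x y : Q.k, x ∈ Q.arithData → y ∈ Q.arithData → x * y ∈ Q.arithData)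
    (hQ₂ : (1 : Q.k) ∈ Q.arithData)
    (u : P.U ≃ₜ Q.U), IsMorphism P.X.str Q.X.str u ∧ IsMorphism Q.X.str P.X.str u.symm →
    ∀ ψA : P.A.F ≃+* Q.A.F, Continuous ψA → Continuous ψA.symm →
      ∃ e : (P.toPair hP₁ hP₂).Iso (Q.toPair hQ₁ hQ₂), e.isoU = u ∧ e.isoA = ψA

/-- P42.i/L04 holds (`ModelAutHolPair.liftIso`). [cite: MochizukiAbsTopIII2015, Proposition 4.2 (i) p.105] -/
theorem modelStructureIsoLifts (T : ArchPairType) : ModelStructureIsoLifts.{u} T :=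
  fun P Q hP₁ hP₂ hQ₁ hQ₂ u hu ψA hψ hψ' =>
    ⟨ModelAutHolPair.liftIso P Q hP₁ hP₂ hQ₁ hQ₂ u hu ψA hψ hψ', rfl, rfl⟩

/-- **P42.i/L05 — statement** (surjectivity for Aut-holomorphic `T`-pairs): for pairs `P`, `Q` presented
(Def 4.1 (ii) (c)) by model pairs through isomorphisms `eP`, `eQ` whose `𝒜`-parts are bicontinuous — in
print every `𝒜`-isomorphism is an induced isomorphism of TOPOLOGICAL fields, so this is no restriction
there; the tree's `AutHolPair.Iso.isoA` carries no continuity datum, whence the explicit binders — every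
structure-isomorphism `u : 𝕏 ⥲ 𝕏*` with its induced `ψA` (junction P42.J27) lifts to an isomorphism of pairs.
[cite: MochizukiAbsTopIII2015, Proposition 4.2 (i) p.105] -/
def StructureIsoLifts (T : ArchPairType) : Prop :=
  ∀ (P Q : AutHolPair.{u}) (P₀ Q₀ : ModelAutHolPair.{u} T)
    (hP₁ : ∀ x y : P₀.k, x ∈ P₀.arithData → y ∈ P₀.arithData → x * y ∈ P₀.arithData)
    (hP₂ : (1 : P₀.k) ∈ P₀.arithData)
    (hQ₁ : ∀ x y : Q₀.k, x ∈ Q₀.arithData → y ∈ Q₀.arithData → x * y ∈ Q₀.arithData)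
    (hQ₂ : (1 : Q₀.k) ∈ Q₀.arithData)
    (eP : (P₀.toPair hP₁ hP₂).Iso P) (eQ : (Q₀.toPair hQ₁ hQ₂).Iso Q),
    Continuous eP.isoA → Continuous eP.isoA.symm → Continuous eQ.isoA → Continuous eQ.isoA.symm →
    ∀ (u : P.U ≃ₜ Q.U), IsMorphism P.X.str Q.X.str u ∧ IsMorphism Q.X.str P.X.str u.symm →
    ∀ ψA : P.A.F ≃+* Q.A.F, Continuous ψA → Continuous ψA.symm →
      ∃ e : P.Iso Q, e.isoU = u ∧ e.isoA = ψA

/-- P42.i/L05 holds: transport the model lift (P42.i/L04) along the presenting isomorphisms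
(`AutHolPair.Iso.symm/trans`). [cite: MochizukiAbsTopIII2015, Proposition 4.2 (i) p.105] -/
theorem structureIsoLifts (T : ArchPairType) : StructureIsoLifts.{u} T := by
  intro P Q P₀ Q₀ hP₁ hP₂ hQ₁ hQ₂ eP eQ heP heP' heQ heQ' u hu ψA hψ hψ'
  have hu₀ := structureIso_trans (structureIso_trans eP.isoU_isMorphism hu) eQ.symm.isoU_isMorphism
  let ψA₀ : P₀.A.F ≃+* Q₀.A.F := eP.isoA.trans (ψA.trans eQ.isoA.symm)
  have hψ₀ : Continuous ψA₀ := heQ'.comp (hψ.comp heP)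
  have hψ₀' : Continuous ψA₀.symm :=
    show Continuous (fun y => eP.isoA.symm (ψA.symm (eQ.isoA y))) from heP'.comp (hψ'.comp heQ)
  let e₀ := ModelAutHolPair.liftIso P₀ Q₀ hP₁ hP₂ hQ₁ hQ₂ ((eP.isoU.trans u).trans eQ.isoU.symm) hu₀
    ψA₀ hψ₀ hψ₀'
  refine ⟨(eP.symm.trans e₀).trans eQ, ?_, ?_⟩
  · ext x
    change eQ.isoU (eQ.isoU.symm (u (eP.isoU (eP.isoU.symm x)))) = u x
    rw [Homeomorph.apply_symm_apply, Homeomorph.apply_symm_apply]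
  · ext a
    change eQ.isoA (eQ.isoA.symm (ψA (eP.isoA (eP.isoA.symm a)))) = ψA a
    rw [RingEquiv.apply_symm_apply, RingEquiv.apply_symm_apply]

/-! ### P42.i/L06 — the bijection, relative to the junction -/

/-- **P42.i/L06 — statement** ([AbsTopIII] Prop 4.2 (i), bijectivity portion, RELATIVE TO THE JUNCTION):
given the assignment `ind` of an isomorphism of fields `𝒜_𝕏 ⥲ 𝒜_𝕏*` to every structure-isomorphism
`𝕏 ⥲ 𝕏*` (the functorial algorithms of Cor 2.7 — junction P42.J27, a binder), "the natural functor of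
Definition 4.1, (iii), induces a bijection `Isom_{𝒞^hol_T}((𝕏 ↶ M),(𝕏* ↶ M*)) ⥲ Isom_EA(𝕏, 𝕏*)`": the map
`e ↦ e.isoU` from the isomorphisms of pairs whose `𝒜`-part is the induced one to the
structure-isomorphisms is bijective.
[cite: MochizukiAbsTopIII2015, Proposition 4.2 (i) p.105] -/
def IsomBijectionRel (P Q : AutHolPair.{u})
    (ind : {u : P.U ≃ₜ Q.U // IsMorphism P.X.str Q.X.str u ∧ IsMorphism Q.X.str P.X.str u.symm} →
      (P.A.F ≃+* Q.A.F)) : Prop :=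
  Function.Bijective
    (fun e : {e : P.Iso Q // e.isoA = ind ⟨e.isoU, e.isoU_isMorphism⟩} =>
      (⟨e.1.isoU, e.1.isoU_isMorphism⟩ :
        {u : P.U ≃ₜ Q.U // IsMorphism P.X.str Q.X.str u ∧ IsMorphism Q.X.str P.X.str u.symm}))

/-- P42.i/L06 from P42.i/L02 (injectivity, tree) and a lifting property (P42.i/L04–L05): if `Q` is an
Aut-holomorphic `T`-pair and every `(u, ind u)` lifts, the map of `IsomBijectionRel` is a bijection.
[cite: MochizukiAbsTopIII2015, Proposition 4.2 (i) p.105] -/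
theorem isomBijectionRel_of_lifts {T : ArchPairType} (P Q : AutHolPair.{u}) (hQ : IsAutHolPair T Q)
    (ind : {u : P.U ≃ₜ Q.U // IsMorphism P.X.str Q.X.str u ∧ IsMorphism Q.X.str P.X.str u.symm} →
      (P.A.F ≃+* Q.A.F))
    (hlift : ∀ u : {u : P.U ≃ₜ Q.U // IsMorphism P.X.str Q.X.str u ∧ IsMorphism Q.X.str P.X.str u.symm},
      ∃ e : P.Iso Q, e.isoU = u.1 ∧ e.isoA = ind u) :
    IsomBijectionRel P Q ind := by
  constructor
  · rintro ⟨e, he⟩ ⟨f, hf⟩ h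
    have hU : e.isoU = f.isoU := congrArg Subtype.val h
    apply Subtype.ext
    refine AutHolPair.Iso.eq_of_isoU_eq_of_isoA_eq hQ e f hU ?_
    rw [he, hf]
    congr 1
  · rintro ⟨u, hu⟩
    obtain ⟨e, heU, heA⟩ := hlift ⟨u, hu⟩
    subst heU
    exact ⟨⟨e, heA⟩, rfl⟩

end

end Literature.AnabelianGeometry.AbsoluteAnabelian
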